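import Literature.AnabelianGeometry.EtaleTheta.Discharge.Sec2Prop24ModelCharacteristic
import Literature.AnabelianGeometry.EtaleTheta.Thm16SubdagStatements
import HarnessLib

/-!
# [EtTh] §1: the binder `KerToZIsCompactlyGenerated` (SUBDAG-EtTh-Thm16 L02 / GAP G-L6d6-1) from ANY description of
# `Π^tp_Y` as the topological normal closure of compact subgroups (proof-only)

S. Mochizuki, *The étale theta function …* [EtTh], Publ. RIMS **45** (2009), §1 p. 12: "the universal graph-covering of
the dual graph of this special fiber determines … a natural surjection `Π^tp_X ↠ Z` … whose kernel … `Π^tp_Y`"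
[cite: MochizukiEtTh2009, §1 p.12]; [SemiAnbd] Thm. 3.7 (iii)–(iv) (verticial subgroups = maximal compact subgroups of
`π₁^temp(𝒢)`; the kernel of `π₁^temp(𝒢) ↠ π₁^top(𝔾)` is the closed normal subgroup they generate).

Cell abc-iut, seat abc-iut-L6-d6 (gen 3); L2-lead ROW #3 (gen 3 04:01:23Z (R6) «tempered-chart bridge») — census result
`D-G-L6d6-1`: the L3 interface `SpecialFibreTower` does NOT yet carry the graph quotient of the level-`0` chart nor its
identification with the §1 root datum `toZ` (wanted fields (M1)/(M2), INBOX abc-iut-L3-t2). THIS FILE lands the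
CARRIER-INDEPENDENT half of the bridge now, so that whichever carrier L3 chooses closes the gap in one line:

* `ThetaSetting.kerToZIsCompactlyGenerated_of_normalClosure`: if `Π^tp_Y = (normalClosure ⋃ᵢ Kᵢ)⁻` for ANY family of COMPACT
  subgroups `Kᵢ ⊆ Π^tp_X` (the shape of (M2) read through (M1): `Kᵢ` = the verticial subgroups of an arithmetic chart), then
  abc-iut-L6-d5's `Thm16Sub.KerToZIsCompactlyGenerated D` HOLDS — `⊆`: conjugates of compact subgroups are compact; `⊇`: my
  PROVED `ThetaSetting.closure_compact_le_GtpY` (compact subgroups die in the discrete torsion-free `Z`);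
* `ThetaSetting.EtaleThetaData.DoubleUnderline.hYuu_of_normalClosure`: the same for the `X̲̲`-reading (binder `hYuu` of
  `map_GtpY_subgroupOf_Huu_eq_of_compactlyGenerated`, G-L6d6-1) inside `Π^tp_{X̲̲}`.

PROOF-ONLY (no definition, no new named fact); nothing here asserts the (M1)/(M2) description — it stays the binder of
G-L6d6-1 until L3 supplies it; no side is taken on [IUTchIII] Cor. 3.12; typed ≠ proved.
-/

noncomputable section

namespace Literature.AnabelianGeometry.EtaleTheta

open Topology

/-! ### Folklore engine (private): normal closures of unions of compact subgroups -/

section Folklore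

variable {G : Type*} [Group G] [TopologicalSpace G] [IsTopologicalGroup G]

/-- Conjugates of elements of compact subgroups are elements of compact subgroups. [folklore] -/
private theorem conj_mem_compactElements {ι : Sort*} (K : ι → Subgroup G) (hK : ∀ i, IsCompact (K i : Set G))
    (g x : G) (hx : x ∈ ⋃ i, (K i : Set G)) :
    g * x * g⁻¹ ∈ {y : G | ∃ C : Subgroup G, IsCompact (C : Set G) ∧ y ∈ C} := by
  obtain ⟨i, hxi⟩ := Set.mem_iUnion.mp hx
  refine ⟨(K i).map (MulAut.conj g).toMonoidHom, ?_, ⟨x, hxi, rfl⟩⟩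
  rw [Subgroup.coe_map]
  exact (hK i).image (by change Continuous fun y : G => g * y * g⁻¹; fun_prop)

/-- The topological normal closure of a union of compact subgroups lies in the topological closure of the subgroup
generated by all elements of compact subgroups. [folklore] -/
private theorem normalClosure_compact_le {ι : Sort*} (K : ι → Subgroup G) (hK : ∀ i, IsCompact (K i : Set G)) :
    (Subgroup.normalClosure (⋃ i, (K i : Set G))).topologicalClosure ≤
      (Subgroup.closure {y : G | ∃ C : Subgroup G, IsCompact (C : Set G) ∧ y ∈ C}).topologicalClosure := by
  apply Subgroup.topologicalClosure_mono
  rw [Subgroup.normalClosure, Subgroup.closure_le]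
  intro x hx
  obtain ⟨a, ha, hax⟩ := Group.mem_conjugatesOfSet_iff.mp hx
  obtain ⟨c, rfl⟩ := isConj_iff.mp hax
  exact Subgroup.subset_closure (conj_mem_compactElements K hK c a ha)

end Folklore

namespace ThetaSetting

variable {p : ℕ} [Fact p.Prime] (D : ThetaSetting p)

/-- **L02 / G-L6d6-1 from a normal-closure description of `Π^tp_Y`**: if `Π^tp_Y = Ker(Π^tp_X ↠ Z)` is the topological
normal closure of some family of COMPACT subgroups of `Π^tp_X` ([EtTh] p. 12: `Y` is the universal graph-covering of the
dual graph, so `Π^tp_Y` is generated by the (compact) decomposition groups of the irreducible components — [SemiAnbd] Thm.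
3.7 (iii)–(iv)), then abc-iut-L6-d5's binder `Thm16Sub.KerToZIsCompactlyGenerated D` holds. The inclusion `⊇` is the
theorem `closure_compact_le_GtpY`. [cite: MochizukiEtTh2009, §1 p.12] -/
theorem kerToZIsCompactlyGenerated_of_normalClosure {ι : Sort*} (K : ι → Subgroup D.PiTemp)
    (hK : ∀ i, IsCompact (K i : Set D.PiTemp))
    (hY : D.GtpY = (Subgroup.normalClosure (⋃ i, (K i : Set D.PiTemp))).topologicalClosure) :
    Thm16Sub.KerToZIsCompactlyGenerated D :=
  le_antisymm (hY.le.trans (normalClosure_compact_le K hK)) D.closure_compact_le_GtpY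

/-- The same with `Π^tp_Y` only CONTAINED in such a normal closure (the other inclusion being automatic when the `Kᵢ` lie in
`Π^tp_Y`, e.g. for verticial subgroups, by `le_GtpY_of_isCompact`). [cite: MochizukiEtTh2009, §1 p.12] -/
theorem kerToZIsCompactlyGenerated_of_le_normalClosure {ι : Sort*} (K : ι → Subgroup D.PiTemp)
    (hK : ∀ i, IsCompact (K i : Set D.PiTemp))
    (hY : D.GtpY ≤ (Subgroup.normalClosure (⋃ i, (K i : Set D.PiTemp))).topologicalClosure) :
    Thm16Sub.KerToZIsCompactlyGenerated D :=
  le_antisymm (hY.trans (normalClosure_compact_le K hK)) D.closure_compact_le_GtpY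

namespace EtaleThetaData.DoubleUnderline

variable {D} {E : D.EtaleThetaData} {l : ℕ} (C : E.DoubleUnderline l)

/-- **The `X̲̲`-reading**: if `Π^tp_{Y̲̲} ⊆ Π^tp_{X̲̲}` is contained in the topological normal closure (in `Π^tp_{X̲̲}`) of a family
of COMPACT subgroups of `Π^tp_{X̲̲}` (the dual graph of `X̲̲` is an `l`-cycle, `Y̲̲` its universal graph-covering), then the
binder `hYuu` of `map_GtpY_subgroupOf_Huu_eq_of_compactlyGenerated` (G-L6d6-1) holds — so every topological automorphism
of `Π^tp_{X̲̲}` stabilises `Π^tp_{Y̲̲}` (`Sec2Prop24ModelCharacteristic`). [cite: MochizukiEtTh2009, Def 2.7 p.41] -/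
theorem hYuu_of_le_normalClosure {ι : Sort*} (K : ι → Subgroup C.Huu) (hK : ∀ i, IsCompact (K i : Set C.Huu))
    (hY : D.GtpY.subgroupOf C.Huu ≤ (Subgroup.normalClosure (⋃ i, (K i : Set C.Huu))).topologicalClosure) :
    D.GtpY.subgroupOf C.Huu ≤
      (Subgroup.closure {h : C.Huu | ∃ K : Subgroup C.Huu, IsCompact (K : Set C.Huu) ∧ h ∈ K}).topologicalClosure :=
  hY.trans (normalClosure_compact_le K hK)

/-- Hence, under such a description, the `Y̲̲`-clause for every topological automorphism of `Π^tp_{X̲̲}`.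
[cite: MochizukiEtTh2009, Prop 2.4 p.38] -/
theorem map_GtpY_subgroupOf_Huu_eq_of_le_normalClosure {ι : Sort*} (K : ι → Subgroup C.Huu)
    (hK : ∀ i, IsCompact (K i : Set C.Huu))
    (hY : D.GtpY.subgroupOf C.Huu ≤ (Subgroup.normalClosure (⋃ i, (K i : Set C.Huu))).topologicalClosure)
    (γ : C.Huu ≃ₜ* C.Huu) :
    (D.GtpY.subgroupOf C.Huu).map γ.toMulEquiv.toMonoidHom = D.GtpY.subgroupOf C.Huu :=
  C.map_GtpY_subgroupOf_Huu_eq_of_compactlyGenerated (C.hYuu_of_le_normalClosure K hK hY) γ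

end EtaleThetaData.DoubleUnderline

end ThetaSetting

end Literature.AnabelianGeometry.EtaleTheta

end
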